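/-
Copyright (c) 2026. All rights reserved.
Released under Apache 2.0 license as described in the file LICENSE.
-/
import Summits.AtomisticToContinuum.Crystallization.Theorems.ChartedZeroExcessLayeredLatticeLiouvilleVZ

/-!
# ChartedZeroExcessLayeredLatticeLiouville — part WA «InPlaneLipschitz»: the IN-PLANE half of brick (4a) — a `ϱ`-truncated-harmonic field on
  `idxBall x₀ n` has in-plane unit differences bounded POINTWISE on `idxBall x₀ (n/2)` by the mean energy, `#B·‖D_E φ(X)‖² ≤ C(c, κ₀)·E_n(φ)`, and
  in-plane second differences by `n⁻²` times the mean energy (decomp-a2c-lens-2, g58; toward brick (4a) `ModalLipschitzAt` of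
  stmt-AtomisticToContinuum-26636, leaf (LD′) `ModalLipschitzZ`)

A pure assembly of tree parts: VE `sup_sq_le_mixed` (the cube sup bound with every cross-layer difference peeled into energies of IN-PLANE iterates)
and VC `caccioppoli_latDiff` (the tangential Caccioppoli inequality), iterated once, twice and three times on nested balls with gap `n/16` and
interaction slack `L = ϱ/c + 2` (so the radius threshold `n ≥ 16L` depends on `ϱ`, the constant does not):
* WA.1 bookkeeping (in-plane axes, monotonicity of the energy in the radius, the site count of `idxBall x₀ n` against the cube of `idxBall x₀ (n/2)`);
* WA.2 `cacc_gap` — Caccioppoli with a gap `g` and slack `L` inside a ball of harmonicity, constant `54F(c)/κ₀` (the inner package of VC's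
  `caccioppoli_latDiff` is threaded as the hypothesis `hP`);
* WA.3 the energies of the first, second and third in-plane iterates on `idxBall x₀ (n/2)` against `E_n(φ)` (`n²`, `n⁴`, `n⁶` weights);
* WA.4 ★★ `inPlane_lipschitz` (`#B_n·‖D_E φ(X)‖² ≤ lipConst·E_n(φ)` on `idxBall x₀ (n/2)`), ★ `inPlane_hessian_core`
  (`n²·#B_n·‖D_E D_{E'} φ(X)‖² ≤ …·E_n(φ)` on `idxBall x₀ (n/4)`), the statement shapes `InPlaneLipschitzShape`, `InPlaneHessianShape` and their witnesses.
The VERTICAL half of (4a) (cross-layer differences of `φ − M`) is NOT here: it needs the flux machinery (VF, VS, VV) and is the remaining piece.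
-/

namespace Summit.AtomisticToContinuum.Crystallization.Theorems.ChartedZeroExcessLayeredLatticeLiouville

open Summit.AtomisticToContinuum.Crystallization.Theorems.ChartedPlanarOrderRigidityDoor (E3)
open Finset
open scoped InnerProductSpace RealInnerProductSpace BigOperators

noncomputable section InPlaneLipschitz

variable {c : ℝ} {a b : E3} {w : ℤ → E3}

/-! ### WA.1  Bookkeeping -/

/-- the in-plane axis `idxAxis₁` has no cross-layer component. [formal bookkeeping] -/
theorem idxAxis₁_snd : idxAxis₁.2 = 0 := rfl

/-- the in-plane axis `idxAxis₂` has no cross-layer component. [formal bookkeeping] -/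
theorem idxAxis₂_snd : idxAxis₂.2 = 0 := rfl

/-- `idxAxis₁` is a step of index size `≤ 1`. [formal bookkeeping] -/
theorem idxNorm_idxAxis₁_le : (idxNorm idxAxis₁ : ℝ) ≤ 1 := by
  have h := dist_add_idxAxis₁_le (0 : Cell 2 × ℤ)
  rwa [dist_eq_idxNorm, zero_add, sub_zero] at h

/-- `idxAxis₂` is a step of index size `≤ 1`. [formal bookkeeping] -/
theorem idxNorm_idxAxis₂_le : (idxNorm idxAxis₂ : ℝ) ≤ 1 := by
  have h := dist_add_idxAxis₂_le (0 : Cell 2 × ℤ)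
  rwa [dist_eq_idxNorm, zero_add, sub_zero] at h

/-- the localised index energy is monotone in the radius of the index ball. [formal bookkeeping] -/
theorem idxEnergy_idxBall_mono (φ : Cell 2 → ℤ → E3) (x₀ : Cell 2 × ℤ) {m n : ℝ} (h : m ≤ n) :
    idxEnergy φ (idxBall x₀ m) ≤ idxEnergy φ (idxBall x₀ n) := by
  rw [← coe_idxBallF, ← coe_idxBallF, idxEnergy_coe_finset, idxEnergy_coe_finset]
  have hsub : idxBallF x₀ m ⊆ idxBallF x₀ n := fun X hX => mem_idxBallF.mpr ((mem_idxBallF.mp hX).trans h)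
  exact Finset.sum_le_sum_of_subset_of_nonneg (Finset.filter_subset_filter _ (Finset.product_subset_product hsub hsub))
    fun _ _ _ => sq_nonneg _

/-- the site count of `idxBall x₀ (n/2)` is the cube `(2⌊n/2⌋₊ + 1)³`, in the currency of part VE's sup bound. [formal bookkeeping] -/
theorem ncard_idxBall_half_eq (x₀ : Cell 2 × ℤ) {n : ℝ} (hn : 0 ≤ n / 2) :
    ((idxBall x₀ (n / 2)).ncard : ℝ) = ((((2 * ⌊n / 2⌋₊ : ℕ) : ℝ) + 1)) ^ 3 := by
  rw [← coe_idxBallF, Set.ncard_coe_finset, card_idxBallF_eq x₀ hn]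
  push_cast
  ring

/-- site count of the ball against the cube of the half ball: `(2⌊n⌋₊ + 1)³ ≤ 27·(2⌊n/2⌋₊ + 1)³`. [formal bookkeeping] -/
theorem ncard_idxBall_le_cube_half (x₀ : Cell 2 × ℤ) {n : ℝ} (hn : 0 ≤ n) :
    ((idxBall x₀ n).ncard : ℝ) ≤ 27 * ((((2 * ⌊n / 2⌋₊ : ℕ) : ℝ) + 1)) ^ 3 := by
  rw [← coe_idxBallF, Set.ncard_coe_finset, card_idxBallF_eq x₀ hn, Nat.floor_div_ofNat]
  have h : 2 * ⌊n⌋₊ + 1 ≤ 3 * (2 * (⌊n⌋₊ / 2) + 1) := by omega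
  have h' : ((2 * ⌊n⌋₊ + 1 : ℕ) : ℝ) ≤ 3 * ((((2 * (⌊n⌋₊ / 2) : ℕ)) : ℝ) + 1) := by exact_mod_cast h
  calc ((((2 * ⌊n⌋₊ + 1) ^ 3 : ℕ)) : ℝ) = ((2 * ⌊n⌋₊ + 1 : ℕ) : ℝ) ^ 3 := by push_cast; ring
    _ ≤ (3 * ((((2 * (⌊n⌋₊ / 2) : ℕ)) : ℝ) + 1)) ^ 3 := pow_le_pow_left₀ (by positivity) h' 3
    _ = 27 * ((((2 * (⌊n⌋₊ / 2) : ℕ)) : ℝ) + 1) ^ 3 := by ring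

/-- the gap algebra: `n²·((n/16)⁻¹)² = 256`. [formal bookkeeping] -/
theorem sq_mul_gap_inv_sq {n : ℝ} (hn : n ≠ 0) : n ^ 2 * ((n / 16)⁻¹) ^ 2 = 256 := by
  rw [inv_div, div_eq_mul_inv, show n ^ 2 * (16 * n⁻¹) ^ 2 = 256 * (n * n⁻¹) ^ 2 by ring, mul_inv_cancel₀ hn]
  norm_num

/-- the gap algebra: `n⁴·((n/16)⁻¹)⁴ = 256²`. [formal bookkeeping] -/
theorem pow_four_mul_gap_inv {n : ℝ} (hn : n ≠ 0) : n ^ 4 * ((n / 16)⁻¹) ^ 4 = 256 ^ 2 := by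
  rw [inv_div, div_eq_mul_inv, show n ^ 4 * (16 * n⁻¹) ^ 4 = 256 ^ 2 * (n * n⁻¹) ^ 4 by ring, mul_inv_cancel₀ hn]
  norm_num

/-- the gap algebra: `n⁶·((n/16)⁻¹)⁶ = 256³`. [formal bookkeeping] -/
theorem pow_six_mul_gap_inv {n : ℝ} (hn : n ≠ 0) : n ^ 6 * ((n / 16)⁻¹) ^ 6 = 256 ^ 3 := by
  rw [inv_div, div_eq_mul_inv, show n ^ 6 * (16 * n⁻¹) ^ 6 = 256 ^ 3 * (n * n⁻¹) ^ 6 by ring, mul_inv_cancel₀ hn]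
  norm_num

/-! ### WA.2  Caccioppoli with a gap inside a ball of harmonicity -/

/-- ★ CACCIOPPOLI WITH A GAP: under the inner package `hP` of part VC's `caccioppoli_latDiff` (fixed truncation `ϱ` and laminate), if `χ` is
`ϱ`-truncated-harmonic on `idxBall x₀ R₁` and `r + g + (ϱ/c + 2) ≤ R₁` with `g > 0`, then `E_r(D_E χ) ≤ (54F(c)/κ₀)·g⁻²·E_{R₁}(χ)` for every in-plane
step `E` of size `≤ 1`. [this file, g58; VC + monotonicity of the energy in the radius] -/
theorem cacc_gap (hc : 0 < c) {κ₀ ϱ : ℝ} (hκ₀ : 0 < κ₀) (hϱ : 0 ≤ ϱ)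
    (hP : ∀ E₀ : Cell 2 × ℤ, E₀.2 = 0 → (idxNorm E₀ : ℝ) ≤ 1 → ∀ (y₀ : Cell 2 × ℤ) (r' n' : ℝ), r' < n' → ∀ ψ : Cell 2 → ℤ → E3,
      IsTruncHarmonicZ ϱ a b w ψ (idxBall y₀ (n' + 1)) →
        κ₀ * idxEnergy (latDiff E₀ ψ) (idxBall y₀ r') ≤ 54 * kernelConst c * ((n' - r')⁻¹) ^ 2 * idxEnergy ψ (idxBall y₀ (n' + ϱ / c + 1)))
    {E : Cell 2 × ℤ} (hE : E.2 = 0)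
    (hE1 : (idxNorm E : ℝ) ≤ 1) (x₀ : Cell 2 × ℤ) {r g R₁ : ℝ} (hg : 0 < g) (hR : r + g + (ϱ / c + 2) ≤ R₁) {χ : Cell 2 → ℤ → E3}
    (hχ : IsTruncHarmonicZ ϱ a b w χ (idxBall x₀ R₁)) :
    idxEnergy (latDiff E χ) (idxBall x₀ r) ≤ 54 * kernelConst c / κ₀ * (g⁻¹) ^ 2 * idxEnergy χ (idxBall x₀ R₁) := by
  have hϱc : 0 ≤ ϱ / c := div_nonneg hϱ hc.le
  have hχ' : IsTruncHarmonicZ ϱ a b w χ (idxBall x₀ (r + g + 1)) := isTruncHarmonicZ_mono hχ (idxBall_mono x₀ (by linarith))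
  have h1 := hP E hE hE1 x₀ r (r + g) (by linarith) χ hχ'
  rw [add_sub_cancel_left] at h1
  have h2 : idxEnergy χ (idxBall x₀ (r + g + ϱ / c + 1)) ≤ idxEnergy χ (idxBall x₀ R₁) := idxEnergy_idxBall_mono χ x₀ (by linarith)
  have hF := kernelConst_nonneg hc
  have h3 : κ₀ * idxEnergy (latDiff E χ) (idxBall x₀ r) ≤ 54 * kernelConst c * (g⁻¹) ^ 2 * idxEnergy χ (idxBall x₀ R₁) :=
    h1.trans (mul_le_mul_of_nonneg_left h2 (by positivity))
  calc idxEnergy (latDiff E χ) (idxBall x₀ r) = κ₀⁻¹ * (κ₀ * idxEnergy (latDiff E χ) (idxBall x₀ r)) := by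
        rw [inv_mul_cancel_left₀ hκ₀.ne']
    _ ≤ κ₀⁻¹ * (54 * kernelConst c * (g⁻¹) ^ 2 * idxEnergy χ (idxBall x₀ R₁)) := mul_le_mul_of_nonneg_left h3 (inv_nonneg.mpr hκ₀.le)
    _ = 54 * kernelConst c / κ₀ * (g⁻¹) ^ 2 * idxEnergy χ (idxBall x₀ R₁) := by ring

/-! ### WA.3  Energies of the in-plane iterates on the half ball -/

/-- first iterate: `n²·E_{n/2}(D_E φ) ≤ 256·(54F/κ₀)·E_n(φ)` for `φ` `ϱ`-truncated-harmonic on `idxBall x₀ n`, `n ≥ 16(ϱ/c + 2)`. [this file, g58] -/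
theorem energy_iterate₁_le (hc : 0 < c) {κ₀ ϱ : ℝ} (hκ₀ : 0 < κ₀) (hϱ : 0 ≤ ϱ)
    (hP : ∀ E₀ : Cell 2 × ℤ, E₀.2 = 0 → (idxNorm E₀ : ℝ) ≤ 1 → ∀ (y₀ : Cell 2 × ℤ) (r' n' : ℝ), r' < n' → ∀ ψ : Cell 2 → ℤ → E3,
      IsTruncHarmonicZ ϱ a b w ψ (idxBall y₀ (n' + 1)) →
        κ₀ * idxEnergy (latDiff E₀ ψ) (idxBall y₀ r') ≤ 54 * kernelConst c * ((n' - r')⁻¹) ^ 2 * idxEnergy ψ (idxBall y₀ (n' + ϱ / c + 1)))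
    {E : Cell 2 × ℤ} (hE : E.2 = 0)
    (hE1 : (idxNorm E : ℝ) ≤ 1) (x₀ : Cell 2 × ℤ) {n : ℝ} (hn : 16 * (ϱ / c + 2) ≤ n) {φ : Cell 2 → ℤ → E3}
    (hφ : IsTruncHarmonicZ ϱ a b w φ (idxBall x₀ n)) :
    n ^ 2 * idxEnergy (latDiff E φ) (idxBall x₀ (n / 2)) ≤ 256 * (54 * kernelConst c / κ₀) * idxEnergy φ (idxBall x₀ n) := by
  have hL : 2 ≤ ϱ / c + 2 := by have := div_nonneg hϱ hc.le; linarith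
  have hn0 : 0 < n := by linarith
  have h := cacc_gap hc hκ₀ hϱ hP hE hE1 x₀ (r := n / 2) (g := n / 16) (R₁ := n) (by positivity) (by linarith) hφ
  calc n ^ 2 * idxEnergy (latDiff E φ) (idxBall x₀ (n / 2))
      ≤ n ^ 2 * (54 * kernelConst c / κ₀ * ((n / 16)⁻¹) ^ 2 * idxEnergy φ (idxBall x₀ n)) := mul_le_mul_of_nonneg_left h (by positivity)
    _ = (n ^ 2 * ((n / 16)⁻¹) ^ 2) * (54 * kernelConst c / κ₀) * idxEnergy φ (idxBall x₀ n) := by ring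
    _ = 256 * (54 * kernelConst c / κ₀) * idxEnergy φ (idxBall x₀ n) := by rw [sq_mul_gap_inv_sq hn0.ne']

/-- second iterate: `n⁴·E_{n/2}(D_{E'} D_E φ) ≤ 256²·(54F/κ₀)²·E_n(φ)` (two Caccioppoli steps, gap `n/16` each). [this file, g58] -/
theorem energy_iterate₂_le (hc : 0 < c) {κ₀ ϱ : ℝ} (hκ₀ : 0 < κ₀) (hϱ : 0 ≤ ϱ)
    (hP : ∀ E₀ : Cell 2 × ℤ, E₀.2 = 0 → (idxNorm E₀ : ℝ) ≤ 1 → ∀ (y₀ : Cell 2 × ℤ) (r' n' : ℝ), r' < n' → ∀ ψ : Cell 2 → ℤ → E3,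
      IsTruncHarmonicZ ϱ a b w ψ (idxBall y₀ (n' + 1)) →
        κ₀ * idxEnergy (latDiff E₀ ψ) (idxBall y₀ r') ≤ 54 * kernelConst c * ((n' - r')⁻¹) ^ 2 * idxEnergy ψ (idxBall y₀ (n' + ϱ / c + 1)))
    {E : Cell 2 × ℤ} (hE : E.2 = 0)
    (hE1 : (idxNorm E : ℝ) ≤ 1) {E' : Cell 2 × ℤ} (hE' : E'.2 = 0) (hE'1 : (idxNorm E' : ℝ) ≤ 1) (x₀ : Cell 2 × ℤ) {n : ℝ}
    (hn : 16 * (ϱ / c + 2) ≤ n) {φ : Cell 2 → ℤ → E3} (hφ : IsTruncHarmonicZ ϱ a b w φ (idxBall x₀ n)) :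
    n ^ 4 * idxEnergy (latDiff E' (latDiff E φ)) (idxBall x₀ (n / 2)) ≤ 256 ^ 2 * (54 * kernelConst c / κ₀) ^ 2 * idxEnergy φ (idxBall x₀ n) := by
  have hL : 2 ≤ ϱ / c + 2 := by have := div_nonneg hϱ hc.le; linarith
  have hn0 : 0 < n := by linarith
  have hF := kernelConst_nonneg hc
  have hψ : IsTruncHarmonicZ ϱ a b w (latDiff E φ) (idxBall x₀ (n - 1)) := isTruncHarmonicZ_latDiff zero_le_one hE hE1 hφ
  have hψ' : IsTruncHarmonicZ ϱ a b w (latDiff E φ) (idxBall x₀ (n / 2 + n / 16 + (ϱ / c + 2))) :=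
    isTruncHarmonicZ_mono hψ (idxBall_mono x₀ (by linarith))
  have hA := cacc_gap hc hκ₀ hϱ hP hE' hE'1 x₀ (r := n / 2) (g := n / 16) (R₁ := n / 2 + n / 16 + (ϱ / c + 2)) (by positivity) le_rfl hψ'
  have hB := cacc_gap hc hκ₀ hϱ hP hE hE1 x₀ (r := n / 2 + n / 16 + (ϱ / c + 2)) (g := n / 16) (R₁ := n) (by positivity) (by linarith) hφ
  have hAB : idxEnergy (latDiff E' (latDiff E φ)) (idxBall x₀ (n / 2)) ≤
      54 * kernelConst c / κ₀ * ((n / 16)⁻¹) ^ 2 * (54 * kernelConst c / κ₀ * ((n / 16)⁻¹) ^ 2 * idxEnergy φ (idxBall x₀ n)) :=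
    hA.trans (mul_le_mul_of_nonneg_left hB (by positivity))
  calc n ^ 4 * idxEnergy (latDiff E' (latDiff E φ)) (idxBall x₀ (n / 2))
      ≤ n ^ 4 * (54 * kernelConst c / κ₀ * ((n / 16)⁻¹) ^ 2 * (54 * kernelConst c / κ₀ * ((n / 16)⁻¹) ^ 2 * idxEnergy φ (idxBall x₀ n))) :=
        mul_le_mul_of_nonneg_left hAB (by positivity)
    _ = (n ^ 4 * ((n / 16)⁻¹) ^ 4) * (54 * kernelConst c / κ₀) ^ 2 * idxEnergy φ (idxBall x₀ n) := by ring
    _ = 256 ^ 2 * (54 * kernelConst c / κ₀) ^ 2 * idxEnergy φ (idxBall x₀ n) := by rw [pow_four_mul_gap_inv hn0.ne']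

/-- third iterate: `n⁶·E_{n/2}(D₁ D₂ D_E φ) ≤ 256³·(54F/κ₀)³·E_n(φ)` (three Caccioppoli steps, gap `n/16` each). [this file, g58] -/
theorem energy_iterate₃_le (hc : 0 < c) {κ₀ ϱ : ℝ} (hκ₀ : 0 < κ₀) (hϱ : 0 ≤ ϱ)
    (hP : ∀ E₀ : Cell 2 × ℤ, E₀.2 = 0 → (idxNorm E₀ : ℝ) ≤ 1 → ∀ (y₀ : Cell 2 × ℤ) (r' n' : ℝ), r' < n' → ∀ ψ : Cell 2 → ℤ → E3,
      IsTruncHarmonicZ ϱ a b w ψ (idxBall y₀ (n' + 1)) →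
        κ₀ * idxEnergy (latDiff E₀ ψ) (idxBall y₀ r') ≤ 54 * kernelConst c * ((n' - r')⁻¹) ^ 2 * idxEnergy ψ (idxBall y₀ (n' + ϱ / c + 1)))
    {E : Cell 2 × ℤ} (hE : E.2 = 0)
    (hE1 : (idxNorm E : ℝ) ≤ 1) (x₀ : Cell 2 × ℤ) {n : ℝ} (hn : 16 * (ϱ / c + 2) ≤ n) {φ : Cell 2 → ℤ → E3}
    (hφ : IsTruncHarmonicZ ϱ a b w φ (idxBall x₀ n)) :
    n ^ 6 * idxEnergy (latDiff idxAxis₁ (latDiff idxAxis₂ (latDiff E φ))) (idxBall x₀ (n / 2)) ≤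
      256 ^ 3 * (54 * kernelConst c / κ₀) ^ 3 * idxEnergy φ (idxBall x₀ n) := by
  have hL : 2 ≤ ϱ / c + 2 := by have := div_nonneg hϱ hc.le; linarith
  have hn0 : 0 < n := by linarith
  have hF := kernelConst_nonneg hc
  have hψ : IsTruncHarmonicZ ϱ a b w (latDiff E φ) (idxBall x₀ (n - 1)) := isTruncHarmonicZ_latDiff zero_le_one hE hE1 hφ
  have hψ₂ : IsTruncHarmonicZ ϱ a b w (latDiff idxAxis₂ (latDiff E φ)) (idxBall x₀ (n - 1 - 1)) :=
    isTruncHarmonicZ_latDiff zero_le_one idxAxis₂_snd idxNorm_idxAxis₂_le hψ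
  have hψ₂' : IsTruncHarmonicZ ϱ a b w (latDiff idxAxis₂ (latDiff E φ)) (idxBall x₀ (n / 2 + n / 16 + (ϱ / c + 2))) :=
    isTruncHarmonicZ_mono hψ₂ (idxBall_mono x₀ (by linarith))
  have hψ' : IsTruncHarmonicZ ϱ a b w (latDiff E φ) (idxBall x₀ (n / 2 + n / 16 + (ϱ / c + 2) + n / 16 + (ϱ / c + 2))) :=
    isTruncHarmonicZ_mono hψ (idxBall_mono x₀ (by linarith))
  have hA := cacc_gap hc hκ₀ hϱ hP idxAxis₁_snd idxNorm_idxAxis₁_le x₀ (r := n / 2) (g := n / 16) (R₁ := n / 2 + n / 16 + (ϱ / c + 2))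
    (by positivity) le_rfl hψ₂'
  have hB := cacc_gap hc hκ₀ hϱ hP idxAxis₂_snd idxNorm_idxAxis₂_le x₀ (r := n / 2 + n / 16 + (ϱ / c + 2)) (g := n / 16)
    (R₁ := n / 2 + n / 16 + (ϱ / c + 2) + n / 16 + (ϱ / c + 2)) (by positivity) le_rfl hψ'
  have hC := cacc_gap hc hκ₀ hϱ hP hE hE1 x₀ (r := n / 2 + n / 16 + (ϱ / c + 2) + n / 16 + (ϱ / c + 2)) (g := n / 16) (R₁ := n)
    (by positivity) (by linarith) hφ
  have hBC : idxEnergy (latDiff idxAxis₂ (latDiff E φ)) (idxBall x₀ (n / 2 + n / 16 + (ϱ / c + 2))) ≤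
      54 * kernelConst c / κ₀ * ((n / 16)⁻¹) ^ 2 * (54 * kernelConst c / κ₀ * ((n / 16)⁻¹) ^ 2 * idxEnergy φ (idxBall x₀ n)) :=
    hB.trans (mul_le_mul_of_nonneg_left hC (by positivity))
  have hABC : idxEnergy (latDiff idxAxis₁ (latDiff idxAxis₂ (latDiff E φ))) (idxBall x₀ (n / 2)) ≤
      54 * kernelConst c / κ₀ * ((n / 16)⁻¹) ^ 2 *
        (54 * kernelConst c / κ₀ * ((n / 16)⁻¹) ^ 2 * (54 * kernelConst c / κ₀ * ((n / 16)⁻¹) ^ 2 * idxEnergy φ (idxBall x₀ n))) :=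
    hA.trans (mul_le_mul_of_nonneg_left hBC (by positivity))
  calc n ^ 6 * idxEnergy (latDiff idxAxis₁ (latDiff idxAxis₂ (latDiff E φ))) (idxBall x₀ (n / 2))
      ≤ n ^ 6 * (54 * kernelConst c / κ₀ * ((n / 16)⁻¹) ^ 2 *
          (54 * kernelConst c / κ₀ * ((n / 16)⁻¹) ^ 2 * (54 * kernelConst c / κ₀ * ((n / 16)⁻¹) ^ 2 * idxEnergy φ (idxBall x₀ n)))) :=
        mul_le_mul_of_nonneg_left hABC (by positivity)
    _ = (n ^ 6 * ((n / 16)⁻¹) ^ 6) * (54 * kernelConst c / κ₀) ^ 3 * idxEnergy φ (idxBall x₀ n) := by ring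
    _ = 256 ^ 3 * (54 * kernelConst c / κ₀) ^ 3 * idxEnergy φ (idxBall x₀ n) := by rw [pow_six_mul_gap_inv hn0.ne']

/-! ### WA.4  ★★ The in-plane Lipschitz estimate -/

/-- the real arithmetic of the assembly: VE's cube bound with the four energy inputs and the counting facts. [formal bookkeeping] -/
theorem lip_arith {P Q Nc s S₀ e₁ e₂₁ e₂₂ e₃ En Cc n : ℝ} (he₁n : 0 ≤ e₁) (he₂₁n : 0 ≤ e₂₁) (he₂₂n : 0 ≤ e₂₂) (he₃n : 0 ≤ e₃)
    (hs : 0 ≤ s) (hQ0 : 0 ≤ Q) (hQ : Q ≤ 2 * n ^ 2) (hNc : Nc ≤ 27 * P ^ 3)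
    (hsup : P ^ 3 * s ≤ 8 * (S₀ + Q * (3 * e₁) + Q ^ 2 * (e₂₂ + e₂₁ + e₂₂) + Q ^ 3 * e₃))
    (hS₀ : S₀ ≤ En) (he₁ : n ^ 2 * e₁ ≤ 256 * Cc * En) (he₂₁ : n ^ 4 * e₂₁ ≤ 256 ^ 2 * Cc ^ 2 * En)
    (he₂₂ : n ^ 4 * e₂₂ ≤ 256 ^ 2 * Cc ^ 2 * En) (he₃ : n ^ 6 * e₃ ≤ 256 ^ 3 * Cc ^ 3 * En) :
    Nc * s ≤ 216 * (1 + 1536 * Cc + 786432 * Cc ^ 2 + 134217728 * Cc ^ 3) * En := by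
  have hQ2 : Q ^ 2 ≤ 4 * n ^ 4 := (pow_le_pow_left₀ hQ0 hQ 2).trans (le_of_eq (by ring))
  have hQ3 : Q ^ 3 ≤ 8 * n ^ 6 := (pow_le_pow_left₀ hQ0 hQ 3).trans (le_of_eq (by ring))
  have t1 : Q * (3 * e₁) ≤ 6 * (256 * Cc * En) :=
    calc Q * (3 * e₁) ≤ 2 * n ^ 2 * (3 * e₁) := mul_le_mul_of_nonneg_right hQ (by positivity)
      _ = 6 * (n ^ 2 * e₁) := by ring
      _ ≤ 6 * (256 * Cc * En) := by linarith
  have t2 : Q ^ 2 * (e₂₂ + e₂₁ + e₂₂) ≤ 12 * (256 ^ 2 * Cc ^ 2 * En) :=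
    calc Q ^ 2 * (e₂₂ + e₂₁ + e₂₂) ≤ 4 * n ^ 4 * (e₂₂ + e₂₁ + e₂₂) := mul_le_mul_of_nonneg_right hQ2 (by positivity)
      _ = 4 * (n ^ 4 * e₂₂ + n ^ 4 * e₂₁ + n ^ 4 * e₂₂) := by ring
      _ ≤ 12 * (256 ^ 2 * Cc ^ 2 * En) := by linarith
  have t3 : Q ^ 3 * e₃ ≤ 8 * (256 ^ 3 * Cc ^ 3 * En) :=
    calc Q ^ 3 * e₃ ≤ 8 * n ^ 6 * e₃ := mul_le_mul_of_nonneg_right hQ3 he₃n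
      _ = 8 * (n ^ 6 * e₃) := by ring
      _ ≤ 8 * (256 ^ 3 * Cc ^ 3 * En) := by linarith
  have hP : P ^ 3 * s ≤ 8 * (1 + 1536 * Cc + 786432 * Cc ^ 2 + 134217728 * Cc ^ 3) * En := by nlinarith
  calc Nc * s ≤ 27 * P ^ 3 * s := mul_le_mul_of_nonneg_right hNc hs
    _ = 27 * (P ^ 3 * s) := by ring
    _ ≤ 27 * (8 * (1 + 1536 * Cc + 786432 * Cc ^ 2 + 134217728 * Cc ^ 3) * En) := by linarith
    _ = 216 * (1 + 1536 * Cc + 786432 * Cc ^ 2 + 134217728 * Cc ^ 3) * En := by ring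

/-- the constant of the in-plane Lipschitz estimate, `216·(1 + 1536·Cc + 786432·Cc² + 134217728·Cc³)` with `Cc = 54F(c)/κ₀` — a function of the
co-Lipschitz constant and the coercivity constant only (uniform in the truncation `ϱ`). [this file, g58] -/
def lipConst (c κ₀ : ℝ) : ℝ :=
  216 * (1 + 1536 * (54 * kernelConst c / κ₀) + 786432 * (54 * kernelConst c / κ₀) ^ 2 + 134217728 * (54 * kernelConst c / κ₀) ^ 3)

/-- `lipConst c κ₀ ≥ 1`. [formal bookkeeping] -/
theorem one_le_lipConst (hc : 0 < c) {κ₀ : ℝ} (hκ₀ : 0 < κ₀) : 1 ≤ lipConst c κ₀ := by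
  have hF := kernelConst_nonneg hc
  have hCc : 0 ≤ 54 * kernelConst c / κ₀ := by positivity
  unfold lipConst
  nlinarith [pow_nonneg hCc 2, pow_nonneg hCc 3]

/-- ★★ **IN-PLANE LIPSCHITZ ESTIMATE, core form**: for `φ` `ϱ`-truncated-harmonic on `idxBall x₀ n` with `n ≥ 16(ϱ/c + 2)`, every in-plane step `E`
of size `≤ 1` and every `X ∈ idxBall x₀ (n/2)`, `#(idxBall x₀ n)·‖D_E φ(X)‖² ≤ lipConst c κ₀ · E_n(φ)` — the pointwise in-plane gradient is bounded by
the root mean energy, uniformly in `ϱ` (VE `sup_sq_le_mixed` + WA.3). [this file, g58] -/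
theorem inPlane_lipschitz_core (hc : 0 < c) {κ₀ ϱ : ℝ} (hκ₀ : 0 < κ₀) (hϱ : 0 ≤ ϱ)
    (hP : ∀ E₀ : Cell 2 × ℤ, E₀.2 = 0 → (idxNorm E₀ : ℝ) ≤ 1 → ∀ (y₀ : Cell 2 × ℤ) (r' n' : ℝ), r' < n' → ∀ ψ : Cell 2 → ℤ → E3,
      IsTruncHarmonicZ ϱ a b w ψ (idxBall y₀ (n' + 1)) →
        κ₀ * idxEnergy (latDiff E₀ ψ) (idxBall y₀ r') ≤ 54 * kernelConst c * ((n' - r')⁻¹) ^ 2 * idxEnergy ψ (idxBall y₀ (n' + ϱ / c + 1)))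
    {E : Cell 2 × ℤ}
    (hE : E.2 = 0) (hE1 : (idxNorm E : ℝ) ≤ 1) (x₀ : Cell 2 × ℤ) {n : ℝ} (hn : 16 * (ϱ / c + 2) ≤ n) {φ : Cell 2 → ℤ → E3}
    (hφ : IsTruncHarmonicZ ϱ a b w φ (idxBall x₀ n)) {X : Cell 2 × ℤ} (hX : X ∈ idxBall x₀ (n / 2)) :
    ((idxBall x₀ n).ncard : ℝ) * ‖latDiff E φ X.1 X.2‖ ^ 2 ≤ lipConst c κ₀ * idxEnergy φ (idxBall x₀ n) := by
  have hL : 2 ≤ ϱ / c + 2 := by have := div_nonneg hϱ hc.le; linarith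
  have hn0 : 0 < n := by linarith
  have hm0 : 0 ≤ n / 2 := by positivity
  have hF := kernelConst_nonneg hc
  have hsup := sup_sq_le_mixed x₀ hm0 (latDiff E φ) (mem_idxBallF.mpr hX)
  have hS₀ := (sum_norm_latDiff_sq_le x₀ (n / 2) φ hE1).trans (idxEnergy_idxBall_mono φ x₀ (show n / 2 + 1 ≤ n by linarith))
  have he₁ := energy_iterate₁_le hc hκ₀ hϱ hP hE hE1 x₀ hn hφ
  have he₂₁ := energy_iterate₂_le hc hκ₀ hϱ hP hE hE1 idxAxis₁_snd idxNorm_idxAxis₁_le x₀ hn hφ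
  have he₂₂ := energy_iterate₂_le hc hκ₀ hϱ hP hE hE1 idxAxis₂_snd idxNorm_idxAxis₂_le x₀ hn hφ
  have he₃ := energy_iterate₃_le hc hκ₀ hϱ hP hE hE1 x₀ hn hφ
  have hR : ((2 * ⌊n / 2⌋₊ : ℕ) : ℝ) ≤ n := by
    have := Nat.floor_le hm0
    push_cast
    linarith
  have hQ : ((((2 * ⌊n / 2⌋₊ : ℕ) : ℝ) + 1)) * ((2 * ⌊n / 2⌋₊ : ℕ) : ℝ) ≤ 2 * n ^ 2 := by
    have h1 : ((((2 * ⌊n / 2⌋₊ : ℕ) : ℝ) + 1)) * ((2 * ⌊n / 2⌋₊ : ℕ) : ℝ) ≤ (n + 1) * n :=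
      mul_le_mul (by linarith) hR (Nat.cast_nonneg _) (by linarith)
    nlinarith
  exact lip_arith (idxEnergy_nonneg _ _) (idxEnergy_nonneg _ _) (idxEnergy_nonneg _ _) (idxEnergy_nonneg _ _) (sq_nonneg _) (by positivity) hQ
    (ncard_idxBall_le_cube_half x₀ hn0.le) hsup hS₀ he₁ he₂₁ he₂₂ he₃

/-- ★★ **IN-PLANE LIPSCHITZ ESTIMATE** (packaged over certified laminates): for every co-Lipschitz constant `c` and coercivity constant `κ₀` there is
a truncation threshold `ϱ_C ≥ 1` such that for all `ϱ ≥ ϱ_C`, all `κ₀`-coercive `c`-layered crystals, all in-plane steps `E` of size `≤ 1`, all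
balls with `n ≥ 16(ϱ/c + 2)` and all `φ` `ϱ`-truncated-harmonic on `idxBall x₀ n`:
`#(idxBall x₀ n)·‖D_E φ(X)‖² ≤ lipConst c κ₀ · E_n(φ)` on `idxBall x₀ (n/2)`. [this file, g58; giaquinta1984 Ch. III in lattice form, tangential part] -/
theorem inPlane_lipschitz (hc : 0 < c) {κ₀ : ℝ} (hκ₀ : 0 < κ₀) :
    ∃ ϱC : ℝ, 1 ≤ ϱC ∧ ∀ ϱ : ℝ, ϱC ≤ ϱ → ∀ (a b : E3) (w : ℤ → E3), IsLayeredCrystal c a b w → CoerciveZ (layeredKernel a b w) κ₀ →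
      ∀ E : Cell 2 × ℤ, E.2 = 0 → (idxNorm E : ℝ) ≤ 1 →
        ∀ (x₀ : Cell 2 × ℤ) (n : ℝ), 16 * (ϱ / c + 2) ≤ n → ∀ φ : Cell 2 → ℤ → E3, IsTruncHarmonicZ ϱ a b w φ (idxBall x₀ n) →
          ∀ X ∈ idxBall x₀ (n / 2), ((idxBall x₀ n).ncard : ℝ) * ‖latDiff E φ X.1 X.2‖ ^ 2 ≤ lipConst c κ₀ * idxEnergy φ (idxBall x₀ n) := by
  obtain ⟨ϱC, hϱC, h⟩ := caccioppoli_latDiff (c := c) hc hκ₀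
  exact ⟨ϱC, hϱC, fun ϱ hϱ a b w hL hK E hE hE1 x₀ n hn φ hφ X hX =>
    inPlane_lipschitz_core hc hκ₀ (by linarith) (h ϱ hϱ a b w hL hK) hE hE1 x₀ hn hφ hX⟩

/-- ★ **IN-PLANE SECOND DIFFERENCES** (core form): for `φ` `ϱ`-truncated-harmonic on `idxBall x₀ n` with `n ≥ 32(ϱ/c + 2)`, in-plane steps `E, E'` of
size `≤ 1` and `X ∈ idxBall x₀ (n/4)`: `n²·#(idxBall x₀ n)·‖D_E D_{E'} φ(X)‖² ≤ 6912·(54F/κ₀)·lipConst·E_n(φ)` — the Lipschitz estimate for the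
harmonic field `D_{E'} φ` on the half ball, then one Caccioppoli step. This is the in-plane input of brick (4a). [this file, g58] -/
theorem inPlane_hessian_core (hc : 0 < c) {κ₀ ϱ : ℝ} (hκ₀ : 0 < κ₀) (hϱ : 0 ≤ ϱ)
    (hP : ∀ E₀ : Cell 2 × ℤ, E₀.2 = 0 → (idxNorm E₀ : ℝ) ≤ 1 → ∀ (y₀ : Cell 2 × ℤ) (r' n' : ℝ), r' < n' → ∀ ψ : Cell 2 → ℤ → E3,
      IsTruncHarmonicZ ϱ a b w ψ (idxBall y₀ (n' + 1)) →
        κ₀ * idxEnergy (latDiff E₀ ψ) (idxBall y₀ r') ≤ 54 * kernelConst c * ((n' - r')⁻¹) ^ 2 * idxEnergy ψ (idxBall y₀ (n' + ϱ / c + 1)))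
    {E : Cell 2 × ℤ}
    (hE : E.2 = 0) (hE1 : (idxNorm E : ℝ) ≤ 1) {E' : Cell 2 × ℤ} (hE' : E'.2 = 0) (hE'1 : (idxNorm E' : ℝ) ≤ 1) (x₀ : Cell 2 × ℤ) {n : ℝ}
    (hn : 32 * (ϱ / c + 2) ≤ n) {φ : Cell 2 → ℤ → E3} (hφ : IsTruncHarmonicZ ϱ a b w φ (idxBall x₀ n)) {X : Cell 2 × ℤ}
    (hX : X ∈ idxBall x₀ (n / 4)) :
    n ^ 2 * ((idxBall x₀ n).ncard : ℝ) * ‖latDiff E (latDiff E' φ) X.1 X.2‖ ^ 2 ≤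
      6912 * (54 * kernelConst c / κ₀) * lipConst c κ₀ * idxEnergy φ (idxBall x₀ n) := by
  have hL : 2 ≤ ϱ / c + 2 := by have := div_nonneg hϱ hc.le; linarith
  have hn0 : 0 < n := by linarith
  have hm0 : 0 ≤ n / 2 := by positivity
  have hF := kernelConst_nonneg hc
  have h1C := one_le_lipConst hc hκ₀
  have hψ : IsTruncHarmonicZ ϱ a b w (latDiff E' φ) (idxBall x₀ (n / 2)) :=
    isTruncHarmonicZ_mono (isTruncHarmonicZ_latDiff zero_le_one hE' hE'1 hφ) (idxBall_mono x₀ (by linarith))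
  have hX' : X ∈ idxBall x₀ (n / 2 / 2) := by
    have h : dist X x₀ ≤ n / 4 := hX
    show dist X x₀ ≤ n / 2 / 2
    linarith
  have hcore := inPlane_lipschitz_core hc hκ₀ hϱ hP hE hE1 x₀ (n := n / 2) (by linarith) hψ hX'
  have he := energy_iterate₁_le hc hκ₀ hϱ hP hE' hE'1 x₀ (n := n) (by linarith) hφ
  have hN := ncard_idxBall_le_cube_half x₀ hn0.le
  rw [← ncard_idxBall_half_eq x₀ hm0] at hN
  have hs : 0 ≤ ‖latDiff E (latDiff E' φ) X.1 X.2‖ ^ 2 := sq_nonneg _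
  calc n ^ 2 * ((idxBall x₀ n).ncard : ℝ) * ‖latDiff E (latDiff E' φ) X.1 X.2‖ ^ 2
      ≤ n ^ 2 * (27 * ((idxBall x₀ (n / 2)).ncard : ℝ)) * ‖latDiff E (latDiff E' φ) X.1 X.2‖ ^ 2 :=
        mul_le_mul_of_nonneg_right (mul_le_mul_of_nonneg_left hN (by positivity)) hs
    _ = 27 * n ^ 2 * (((idxBall x₀ (n / 2)).ncard : ℝ) * ‖latDiff E (latDiff E' φ) X.1 X.2‖ ^ 2) := by ring
    _ ≤ 27 * n ^ 2 * (lipConst c κ₀ * idxEnergy (latDiff E' φ) (idxBall x₀ (n / 2))) := mul_le_mul_of_nonneg_left hcore (by positivity)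
    _ = 27 * lipConst c κ₀ * (n ^ 2 * idxEnergy (latDiff E' φ) (idxBall x₀ (n / 2))) := by ring
    _ ≤ 27 * lipConst c κ₀ * (256 * (54 * kernelConst c / κ₀) * idxEnergy φ (idxBall x₀ n)) := mul_le_mul_of_nonneg_left he (by positivity)
    _ = 6912 * (54 * kernelConst c / κ₀) * lipConst c κ₀ * idxEnergy φ (idxBall x₀ n) := by ring

/-- the statement shape of the in-plane Lipschitz estimate, in the quantifier order of the column (`C`, `ϱ_C` before `ϱ`; the radius threshold
`n₁` after `ϱ`): the IN-PLANE half of brick (4a) `ModalLipschitzAt`. [this file, g58] -/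
def InPlaneLipschitzShape : Prop :=
  ∀ c : ℝ, 0 < c → ∀ κ₀ : ℝ, 0 < κ₀ → ∃ C : ℝ, 1 ≤ C ∧ ∃ ϱC : ℝ, 1 ≤ ϱC ∧ ∀ ϱ : ℝ, ϱC ≤ ϱ → ∃ n₁ : ℝ, 0 < n₁ ∧
    ∀ (a b : E3) (w : ℤ → E3), IsLayeredCrystal c a b w → CoerciveZ (layeredKernel a b w) κ₀ →
      ∀ E : Cell 2 × ℤ, E.2 = 0 → (idxNorm E : ℝ) ≤ 1 →
        ∀ (x₀ : Cell 2 × ℤ) (n : ℝ), n₁ ≤ n → ∀ φ : Cell 2 → ℤ → E3, IsTruncHarmonicZ ϱ a b w φ (idxBall x₀ n) →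
          ∀ X ∈ idxBall x₀ (n / 2), ((idxBall x₀ n).ncard : ℝ) * ‖latDiff E φ X.1 X.2‖ ^ 2 ≤ C * idxEnergy φ (idxBall x₀ n)

/-- ★★ witness of `InPlaneLipschitzShape`: `C = lipConst c κ₀`, `ϱ_C` from part VC, `n₁ = 16(ϱ/c + 2)`. [this file, g58] -/
theorem inPlaneLipschitzShape_holds : InPlaneLipschitzShape := by
  intro c hc κ₀ hκ₀
  obtain ⟨ϱC, hϱC, h⟩ := inPlane_lipschitz (c := c) hc hκ₀
  refine ⟨lipConst c κ₀, one_le_lipConst hc hκ₀, ϱC, hϱC, fun ϱ hϱ => ⟨16 * (ϱ / c + 2), ?_, fun a b w hL hK E hE hE1 x₀ n hn φ hφ X hX =>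
    h ϱ hϱ a b w hL hK E hE hE1 x₀ n hn φ hφ X hX⟩⟩
  have : 0 ≤ ϱ / c := div_nonneg (by linarith) hc.le
  positivity

/-- the statement shape of the in-plane SECOND-DIFFERENCE estimate (two in-plane steps `E, E'`; the in-plane input of brick (4a)), in the
quantifier order of the column. [this file, g58] -/
def InPlaneHessianShape : Prop :=
  ∀ c : ℝ, 0 < c → ∀ κ₀ : ℝ, 0 < κ₀ → ∃ C : ℝ, 1 ≤ C ∧ ∃ ϱC : ℝ, 1 ≤ ϱC ∧ ∀ ϱ : ℝ, ϱC ≤ ϱ → ∃ n₁ : ℝ, 0 < n₁ ∧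
    ∀ (a b : E3) (w : ℤ → E3), IsLayeredCrystal c a b w → CoerciveZ (layeredKernel a b w) κ₀ →
      ∀ E : Cell 2 × ℤ, E.2 = 0 → (idxNorm E : ℝ) ≤ 1 → ∀ E' : Cell 2 × ℤ, E'.2 = 0 → (idxNorm E' : ℝ) ≤ 1 →
        ∀ (x₀ : Cell 2 × ℤ) (n : ℝ), n₁ ≤ n → ∀ φ : Cell 2 → ℤ → E3, IsTruncHarmonicZ ϱ a b w φ (idxBall x₀ n) →
          ∀ X ∈ idxBall x₀ (n / 4),
            n ^ 2 * ((idxBall x₀ n).ncard : ℝ) * ‖latDiff E (latDiff E' φ) X.1 X.2‖ ^ 2 ≤ C * idxEnergy φ (idxBall x₀ n)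

/-- ★ witness of `InPlaneHessianShape`: `C = max 1 (6912·(54F/κ₀)·lipConst c κ₀)`, `ϱ_C` from part VC, `n₁ = 32(ϱ/c + 2)`. [this file, g58] -/
theorem inPlaneHessianShape_holds : InPlaneHessianShape := by
  intro c hc κ₀ hκ₀
  obtain ⟨ϱC, hϱC, h⟩ := caccioppoli_latDiff (c := c) hc hκ₀
  refine ⟨max 1 (6912 * (54 * kernelConst c / κ₀) * lipConst c κ₀), le_max_left _ _, ϱC, hϱC, fun ϱ hϱ => ⟨32 * (ϱ / c + 2), ?_, ?_⟩⟩
  · have : 0 ≤ ϱ / c := div_nonneg (by linarith) hc.le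
    positivity
  · intro a b w hL hK E hE hE1 E' hE' hE'1 x₀ n hn φ hφ X hX
    exact (inPlane_hessian_core hc hκ₀ (by linarith) (h ϱ hϱ a b w hL hK) hE hE1 hE' hE'1 x₀ hn hφ hX).trans
      (mul_le_mul_of_nonneg_right (le_max_right _ _) (idxEnergy_nonneg _ _))

end InPlaneLipschitz

end Summit.AtomisticToContinuum.Crystallization.Theorems.ChartedZeroExcessLayeredLatticeLiouville
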